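import Summits.BirchSwinnertonDyer.BirchSwinnertonDyer.Theorems.ThetaPartnerAtTwoSignedMainConjectureCMTwoRankZeroLowerOffTwo
import Summits.BirchSwinnertonDyer.BirchSwinnertonDyer.Theorems.ThetaPartnerAtTwoSignedMainConjectureCMTwoRankZeroOfPubOfStubs
import HarnessLib

/-!
# Route `ThetaPartnerAtTwo` (TP2), crux K2r0P `SignedMainConjectureCMTwoRankZeroOfPub` (stmt-BirchSwinnertonDyer-24945),
# line `rankzero` v14: the load-bearing stub (LD±2^k)_A is EXACTLY (LDℓ)_A «`ℓ_𝔭(Λ/(L♭)) ≤ ℓ_𝔭(X⁺(A/ℚ_∞))` at every height-one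
# prime `𝔭 ≠ (2)` of `Λ = ℤ₂⟦T⟧`» granted torsion, and torsion is print at analytic rank `0` — part 2 of 2 (`p = 2`, the crux class)

HONEST FRAMING (cell `pub/bsd-wall`, W-ALL row 1; width seat `bsd-wall-tp2-p2-w2` g2, `--supports` only; the lead `bsd-wall-tp2-p2`
holds the item). THEOREMS ONLY — no definition, no named fact, no instance, no `sorry`, no `Theses` import; this file closes no item;
the crux is NOT proved; BSD is NOT proved by any of this.

* (T) `signedTorsionTwoRankZero_of_pub` — for EVERY `A/ℚ` (globally minimal; no CM hypothesis) of analytic rank `0`, good supersingular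
  at `2`, `a₂ = 0`, every cyclotomic top-generator pair and every dual datum `D` of `Sel⁺(A/ℚ_∞)`: `X⁺ = D.X` is `Λ`-torsion, granted BY
  NAME GZK and Greenberg's five structure facts (the `±`-local inputs of the Euler-characteristic door `signedEulerCharTwo_at_of_local`
  are the LANDED HONDA⁺@2 `SignedEC.PlusLayer.plusHondaSystemTwo_adicCompletion` and LEV0@2).
* NECESSITY `offTwoLower_of_signedLowerDivisibilityUpToTwoPower`: the registered stub ⇒ (LDℓ)_A, PUB-free — the length form is
  LOSSLESS (a `stub-false` witness for (LDℓ)_A refutes the registered stub).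
* SUFFICIENCY `signedLowerDivisibilityUpToTwoPower_of_torsion_of_offTwoLower`: (T) + (LDℓ)_A ⇒ the registered stub signature VERBATIM
  (part 1 §2 datum by datum) — the socket a port of Pollack–Rubin / Kato §15 + JLK 2011 at `p = 2` plugs into.
* TURNKEY `signedMainConjectureCMTwoRankZero_body_of_pub_of_offTwoLower_of_flat`: PUB¹⁰ + (LDℓ)_A + (μ♭)_A ⇒ the crux BODY at every
  class member (p594360 `signedMainConjectureCMTwoRankZero_body_of_pub_of_stubs` ∘ SUFFICIENCY ∘ (T)) — the composition of a
  `rankzero` skeleton whose load-bearing stub is (LDℓ)_A.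

(LDℓ)_A, displayed: for every CM `A/ℚ` (globally minimal) of analytic rank `0`, good supersingular at `2`, `a₂ = 0`, `2 ∣ #Ш(A)·∏c_ℓ(A)`,
every cyclotomic datum matching the variable, newform `f`, period ratio `ϖ`, Pollack pair `(L♯, L♭)` at `2` and dual datum `D` of
`Sel⁺(A/ℚ_∞)` with `X⁺` torsion: `ℓ_𝔭(Λ/(L♭)) ≤ ℓ_𝔭(X⁺)` at every height-one `𝔭 ∌ 2` (`L♭ = kobayashiL 1 L♯ L♭`) — the NON-Euler-system
(Eisenstein / elliptic-unit) half of Kobayashi's `+` main conjecture at `2` away from `(2)`; research (Pollack–Rubin 2004 is `p > 2`).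

References: [Kobayashi2003] Thm. 1.2, Thm. 1.3 (i) (p. 2), §8.4; [PollackRubin2004] Thm. 7.3 (p > 2); [BDKim2013] Cor. 3.15 (p. 199);
[GreenbergLNM1716] §4 Lemma 4.2, Props. 4.12–4.13, p. 140; [BurungaleFlach2024] Thm. 1.1; [Kato2004Asterisque] Lemma 15.13, Prop. 15.17.
-/

set_option autoImplicit false
-- the Theorems namespace of this sub repeats the summit name by design (D-0017 nested layout)
set_option linter.dupNamespace false

noncomputable section

open scoped Classical NumberField MatrixGroups ModularForm

open NumberField IsDedekindDomain CongruenceSubgroup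

namespace Summit.BirchSwinnertonDyer.BirchSwinnertonDyer.Theorems

open Literature.NumberTheory.EllipticCurves Literature.NumberTheory.GaloisRepresentations
  WeierstrassCurve ZpExtension Literature.NumberTheory.EllipticCurves.Kobayashi2003
  Literature.NumberTheory.EllipticCurves.Module
  Literature.NumberTheory.EllipticCurves.IwasawaDual Literature.NumberTheory.EllipticCurves.GreenbergVatsal2000
  Literature.NumberTheory.EllipticCurves.ModularForms Literature.NumberTheory.EllipticCurves.Rank1Residual
  Literature.NumberTheory.EllipticCurves.Rank1Residual.Typed
  Summit.BirchSwinnertonDyer.Rank1Residual Summit.BirchSwinnertonDyer.Rank1Residual.Supersingular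

namespace SignedLowerOffTwo

/-! ## §3 `p = 2`: torsion from print; the registered stub (LD±2^k)_A versus (LDℓ)_A; the turnkey -/

section AtTwo

/-- The period ratio of a newform frame is non-zero: `ϖ·Ω_A = Ω⁺_f > 0` (`IsNewform0.plusPeriod_pos_holds`).
[cite: Kobayashi2003, (3.4)–(3.6) (p. 7)] -/
private theorem varpi_ne_zero {W : WeierstrassCurve ℚ} [W.IsElliptic] {N : ℕ} [NeZero N]
    {f : CuspForm (Gamma0 N) 2} (hf : IsNewformOf W f) {ϖ : ℚ}
    (hϖ : (ϖ : ℝ) * W.realPeriodRat = plusPeriod f) : ϖ ≠ 0 := by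
  rintro rfl
  rw [Rat.cast_zero, zero_mul] at hϖ
  exact (IsNewform0.plusPeriod_pos_holds hf.1 hf.coeffField_eq_bot).ne hϖ

/-- **(T) — `X⁺(A/ℚ_∞)` is `Λ`-torsion at analytic rank `0`, FROM PRINT** (no CM hypothesis): for every `A/ℚ` (globally minimal) of
analytic rank `0`, good supersingular at `2` with `a₂ = 0`, every cyclotomic top-generator pair `(κ, γ)` and every Pontryagin-dual
datum `D` of `Sel⁺(A/ℚ_∞)`, `X⁺ = D.X` is `Λ`-torsion — granted BY NAME Gross–Zagier–Kolyvagin (`hGZK`: `Sel_{2^∞}(A/ℚ)` finite,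
`finite_selmerGroupPInfty_two_of_analyticRank_eq_zero`) and Greenberg's five structure facts; the `±`-local inputs of the Euler
characteristic door `signedEulerCharTwo_at_of_local` are the landed HONDA⁺@2 (`SignedEC.PlusLayer.plusHondaSystemTwo_adicCompletion`
through `plusCyclicLayersCMTwo_at_of_honda` / `plusLocKummerCMTwo_at_of_honda`) and LEV0@2 (`localNonDivCMTwo_at`); then
`Sel⁺_∞^γ` finite ⟹ torsion (`SignedSelmerDualData.isTorsion_of_finite_endInvariants`). The torsion input of §2's `←` direction.
[cite: Kobayashi2003, Thm. 1.2 (p. 2), §8.4] [cite: BDKim2013, Cor. 3.15 (p. 199)] [cite: GreenbergLNM1716, §4 Lemma 4.2, Props. 4.12–4.13, p. 140] -/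
theorem signedTorsionTwoRankZero_of_pub
    (hGZK : rank_eq_analyticRank_of_analyticRank_le_one)
    (hC : Greenberg1999.casselsSurjectivity_H1Sigma ℚ)
    (h412 : Greenberg1999.prop412_noFiniteSubmodule_H1Sigma_of_rank_one)
    (hcork : Greenberg1999.h1Sigma_zpCorank_le_degree ℚ)
    (hP108 : Greenberg1999.localQuotient_restriction_surjective ℚ)
    (hWL : Greenberg1999.h1SigmaInfty_rank_eq_one) :
    ∀ (A : WeierstrassCurve ℚ) [A.IsElliptic] [A.IsGloballyMinimal],
      A.analyticRank = 0 → GoodSS A 2 → A.frobeniusTrace 2 = 0 →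
      ∀ (κ : ZpExtension ℚ 2) (γ : Field.absoluteGaloisGroup ℚ), κ.IsCyclotomic → κ.IsTopGenerator γ →
      ∀ D : SignedSelmerDualData A κ γ 1, Module.IsTorsion (IwasawaAlgebra 2) D.X := by
  intro A _ _ hr hss ha κ γ hκ hγ D
  have hSel : Finite (A.selmerGroupPInfty 2) := finite_selmerGroupPInfty_two_of_analyticRank_eq_zero A hGZK hr
  have hEC := signedEulerCharTwo_at_of_local A hss hκ hγ (localNonDivCMTwo_at (A := A) κ hκ)
    (plusCyclicLayersCMTwo_at_of_honda hss
      (fun κ hκ v hv ↦ SignedEC.PlusLayer.plusHondaSystemTwo_adicCompletion A hss ha κ hκ v hv) κ hκ)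
    (plusLocKummerCMTwo_at_of_honda hss
      (fun κ hκ v hv ↦ SignedEC.PlusLayer.plusHondaSystemTwo_adicCompletion A hss ha κ hκ v hv) κ hκ)
    hC h412 hcork hP108 hWL hSel
  exact D.isTorsion_of_finite_endInvariants hγ hEC.1

/-- **NECESSITY: the registered stub (LD±2^k)_A implies (LDℓ)_A** (PUB-free, so the length form is LOSSLESS — a `stub-false` witness
for (LDℓ)_A refutes `stub_signedLowerDivisibilityUpToTwoPowerNonUnitCMTwo` itself): for every class member, cyclotomic datum matching
the variable, newform, period ratio, Pollack pair at `2` and dual datum `D` (torsion or not), `ℓ_𝔭(Λ/(L♭)) ≤ ℓ_𝔭(X⁺(A/ℚ_∞))` at every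
height-one `𝔭 ∌ 2` (`L♭ = kobayashiL 1 L♯ L♭ ≠ 0` by `IsPollackPair`; §2 datum by datum).
[cite: Kobayashi2003, Thm. 1.3 (i) (p. 2)] [cite: PollackRubin2004, Thm. 7.3 (p > 2)] -/
theorem offTwoLower_of_signedLowerDivisibilityUpToTwoPower
    (h : ∀ (A : WeierstrassCurve ℚ) [A.IsElliptic] [A.IsGloballyMinimal],
      A.HasCM → A.analyticRank = 0 → GoodSS A 2 → A.frobeniusTrace 2 = 0 →
      2 ∣ A.shaOrder * A.tamagawaProduct →
      ∀ (κ : ZpExtension ℚ 2) (γ : Field.absoluteGaloisGroup ℚ),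
        κ.IsCyclotomic → κ.IsTopGenerator γ → IsCyclotomicVariable 2 γ →
      ∀ [NeZero (A.conductorNorm ℤ)] (f : CuspForm (Gamma0 (A.conductorNorm ℤ)) 2),
        IsNewformOf A f → ∀ (ϖ : ℚ), (ϖ : ℝ) * A.realPeriodRat = plusPeriod f →
      ∀ (Lplus Lminus : IwasawaAlgebra 2), IsPollackPair f 2 Lplus Lminus →
      ∀ (D : SignedSelmerDualData A κ γ 1),
        ∃ (g h : IwasawaAlgebra 2) (m m' : ℕ), D.charIdeal = Ideal.span {g} ∧
          PowerSeries.C ((2 : ℚ_[2]) ^ m') * iwasawaToPowerSeries 2 g =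
            PowerSeries.C ((2 : ℚ_[2]) ^ m * (ϖ : ℚ_[2])) * iwasawaToPowerSeries 2 (kobayashiL 1 Lplus Lminus * h)) :
    ∀ (A : WeierstrassCurve ℚ) [A.IsElliptic] [A.IsGloballyMinimal],
      A.HasCM → A.analyticRank = 0 → GoodSS A 2 → A.frobeniusTrace 2 = 0 →
      2 ∣ A.shaOrder * A.tamagawaProduct →
      ∀ (κ : ZpExtension ℚ 2) (γ : Field.absoluteGaloisGroup ℚ),
        κ.IsCyclotomic → κ.IsTopGenerator γ → IsCyclotomicVariable 2 γ →
      ∀ [NeZero (A.conductorNorm ℤ)] (f : CuspForm (Gamma0 (A.conductorNorm ℤ)) 2),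
        IsNewformOf A f → ∀ (ϖ : ℚ), (ϖ : ℝ) * A.realPeriodRat = plusPeriod f →
      ∀ (Lplus Lminus : IwasawaAlgebra 2), IsPollackPair f 2 Lplus Lminus →
      ∀ (D : SignedSelmerDualData A κ γ 1), Module.IsTorsion (IwasawaAlgebra 2) D.X →
        ∀ 𝔭 : PrimeSpectrum (IwasawaAlgebra 2), 𝔭.asIdeal.height = 1 →
          PowerSeries.C (2 : ℤ_[2]) ∉ 𝔭.asIdeal →
          lengthAt (IwasawaAlgebra 2) (IwasawaAlgebra 2 ⧸ Ideal.span {kobayashiL 1 Lplus Lminus}) 𝔭 ≤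
            lengthAt (IwasawaAlgebra 2) D.X 𝔭 := by
  intro A _ _ hcm hr hss ha hz κ γ hκ hγ hcv _ f hf ϖ hϖ Lplus Lminus hPP D _ 𝔭 h𝔭 hp𝔭
  have hL : kobayashiL 1 Lplus Lminus ≠ 0 := by
    rw [kobayashiL, if_pos rfl]; exact hPP.2.1
  have h3 := h A hcm hr hss ha hz κ γ hκ hγ hcv f hf ϖ hϖ Lplus Lminus hPP D
  refine lengthAt_quotient_le_of_lowerUpTo (p := 2) hγ D hL (varpi_ne_zero hf hϖ) ?_ 𝔭 h𝔭 ?_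
  · simpa only [Nat.cast_ofNat] using h3
  · simpa only [Nat.cast_ofNat] using hp𝔭

/-- **SUFFICIENCY: (T) + (LDℓ)_A imply the registered stub `stub_signedLowerDivisibilityUpToTwoPowerNonUnitCMTwo` VERBATIM.** Granted a
torsion supplier (T) for the rank-`0` supersingular class at `2` (a theorem from print: `signedTorsionTwoRankZero_of_pub`), the lower
divisibility in local lengths off `2` gives, for every class member and all data, `∃ g h m m', char X⁺ = (g) ∧ 2^{m'}·ι g = 2^m·ϖ·ι(L♭·h)`
(§2 datum by datum). This is the socket a port of Pollack–Rubin / Kato §15 + JLK at `p = 2` plugs into.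
[cite: Kobayashi2003, Thm. 1.3 (i) (p. 2)] [cite: PollackRubin2004, Thm. 7.3 (p > 2)] [cite: Kato2004Asterisque, Lemma 15.13, Prop. 15.17 (pp. 264–265)] -/
theorem signedLowerDivisibilityUpToTwoPower_of_torsion_of_offTwoLower
    (hT : ∀ (A : WeierstrassCurve ℚ) [A.IsElliptic] [A.IsGloballyMinimal],
      A.analyticRank = 0 → GoodSS A 2 → A.frobeniusTrace 2 = 0 →
      ∀ (κ : ZpExtension ℚ 2) (γ : Field.absoluteGaloisGroup ℚ), κ.IsCyclotomic → κ.IsTopGenerator γ →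
      ∀ D : SignedSelmerDualData A κ γ 1, Module.IsTorsion (IwasawaAlgebra 2) D.X)
    (hLD : ∀ (A : WeierstrassCurve ℚ) [A.IsElliptic] [A.IsGloballyMinimal],
      A.HasCM → A.analyticRank = 0 → GoodSS A 2 → A.frobeniusTrace 2 = 0 →
      2 ∣ A.shaOrder * A.tamagawaProduct →
      ∀ (κ : ZpExtension ℚ 2) (γ : Field.absoluteGaloisGroup ℚ),
        κ.IsCyclotomic → κ.IsTopGenerator γ → IsCyclotomicVariable 2 γ →
      ∀ [NeZero (A.conductorNorm ℤ)] (f : CuspForm (Gamma0 (A.conductorNorm ℤ)) 2),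
        IsNewformOf A f → ∀ (ϖ : ℚ), (ϖ : ℝ) * A.realPeriodRat = plusPeriod f →
      ∀ (Lplus Lminus : IwasawaAlgebra 2), IsPollackPair f 2 Lplus Lminus →
      ∀ (D : SignedSelmerDualData A κ γ 1), Module.IsTorsion (IwasawaAlgebra 2) D.X →
        ∀ 𝔭 : PrimeSpectrum (IwasawaAlgebra 2), 𝔭.asIdeal.height = 1 →
          PowerSeries.C (2 : ℤ_[2]) ∉ 𝔭.asIdeal →
          lengthAt (IwasawaAlgebra 2) (IwasawaAlgebra 2 ⧸ Ideal.span {kobayashiL 1 Lplus Lminus}) 𝔭 ≤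
            lengthAt (IwasawaAlgebra 2) D.X 𝔭) :
    ∀ (A : WeierstrassCurve ℚ) [A.IsElliptic] [A.IsGloballyMinimal],
      A.HasCM → A.analyticRank = 0 → GoodSS A 2 → A.frobeniusTrace 2 = 0 →
      2 ∣ A.shaOrder * A.tamagawaProduct →
      ∀ (κ : ZpExtension ℚ 2) (γ : Field.absoluteGaloisGroup ℚ),
        κ.IsCyclotomic → κ.IsTopGenerator γ → IsCyclotomicVariable 2 γ →
      ∀ [NeZero (A.conductorNorm ℤ)] (f : CuspForm (Gamma0 (A.conductorNorm ℤ)) 2),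
        IsNewformOf A f → ∀ (ϖ : ℚ), (ϖ : ℝ) * A.realPeriodRat = plusPeriod f →
      ∀ (Lplus Lminus : IwasawaAlgebra 2), IsPollackPair f 2 Lplus Lminus →
      ∀ (D : SignedSelmerDualData A κ γ 1),
        ∃ (g h : IwasawaAlgebra 2) (m m' : ℕ), D.charIdeal = Ideal.span {g} ∧
          PowerSeries.C ((2 : ℚ_[2]) ^ m') * iwasawaToPowerSeries 2 g =
            PowerSeries.C ((2 : ℚ_[2]) ^ m * (ϖ : ℚ_[2])) * iwasawaToPowerSeries 2 (kobayashiL 1 Lplus Lminus * h) := by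
  intro A _ _ hcm hr hss ha hz κ γ hκ hγ hcv _ f hf ϖ hϖ Lplus Lminus hPP D
  have hL : kobayashiL 1 Lplus Lminus ≠ 0 := by
    rw [kobayashiL, if_pos rfl]; exact hPP.2.1
  have hX : Module.IsTorsion (IwasawaAlgebra 2) D.X := hT A hr hss ha κ γ hκ hγ D
  have h3 := lowerUpTo_of_lengthAt_quotient_le (p := 2) hγ D hX hL (varpi_ne_zero hf hϖ)
    fun 𝔭 h𝔭 hp𝔭 ↦ hLD A hcm hr hss ha hz κ γ hκ hγ hcv f hf ϖ hϖ Lplus Lminus hPP D hX 𝔭 h𝔭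
      (by simpa only [Nat.cast_ofNat] using hp𝔭)
  simpa only [Nat.cast_ofNat] using h3

/-- **TURNKEY: the crux BODY, class-wide, from PUB¹⁰ + (LDℓ)_A + (μ♭)_A** — the composition of a `rankzero` skeleton whose load-bearing
stub is the length form (LDℓ)_A: torsion from print (`signedTorsionTwoRankZero_of_pub`), the registered stub from §3
(`signedLowerDivisibilityUpToTwoPower_of_torsion_of_offTwoLower`), then the landed v12 composition
`signedMainConjectureCMTwoRankZero_body_of_pub_of_stubs` (p594360). For every CM `A/ℚ` (globally minimal) of analytic rank `0`, good
supersingular at `2`, `a₂ = 0`: `X⁺(A/ℚ_∞)` torsion with `μ⁺ = 0` at every cyclotomic top-generator pair, and `KobayashiMainConjecture A 2 1`.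
Nothing is discharged: (LDℓ)_A is the research input (the non-Euler-system half of the `+` main conjecture at `2` off `(2)`), (μ♭)_A
the analytic `μ = 0`. [cite: PollackRubin2004, Thm. 7.3 (p > 2)] [cite: Kobayashi2003, Thm. 1.2, Conjecture (p. 2)] [cite: BurungaleFlach2024, Thm. 1.1] -/
theorem signedMainConjectureCMTwoRankZero_body_of_pub_of_offTwoLower_of_flat
    (hBF : bsdTriple_of_hasCM_of_L_one_ne_zero)
    (hmod : nonempty_modularParametrizationData) (hLrat : hasEntireLFunction_rat)
    (hGZK : rank_eq_analyticRank_of_analyticRank_le_one)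
    (h2 : Literature.NumberTheory.EllipticCurves.realPeriodRat_eq_unit_mul_plusPeriod_two)
    (hC : Greenberg1999.casselsSurjectivity_H1Sigma ℚ)
    (h412 : Greenberg1999.prop412_noFiniteSubmodule_H1Sigma_of_rank_one)
    (hcork : Greenberg1999.h1Sigma_zpCorank_le_degree ℚ)
    (hP108 : Greenberg1999.localQuotient_restriction_surjective ℚ)
    (hWL : Greenberg1999.h1SigmaInfty_rank_eq_one)
    (hLD : ∀ (A : WeierstrassCurve ℚ) [A.IsElliptic] [A.IsGloballyMinimal],
      A.HasCM → A.analyticRank = 0 → GoodSS A 2 → A.frobeniusTrace 2 = 0 →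
      2 ∣ A.shaOrder * A.tamagawaProduct →
      ∀ (κ : ZpExtension ℚ 2) (γ : Field.absoluteGaloisGroup ℚ),
        κ.IsCyclotomic → κ.IsTopGenerator γ → IsCyclotomicVariable 2 γ →
      ∀ [NeZero (A.conductorNorm ℤ)] (f : CuspForm (Gamma0 (A.conductorNorm ℤ)) 2),
        IsNewformOf A f → ∀ (ϖ : ℚ), (ϖ : ℝ) * A.realPeriodRat = plusPeriod f →
      ∀ (Lplus Lminus : IwasawaAlgebra 2), IsPollackPair f 2 Lplus Lminus →
      ∀ (D : SignedSelmerDualData A κ γ 1), Module.IsTorsion (IwasawaAlgebra 2) D.X →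
        ∀ 𝔭 : PrimeSpectrum (IwasawaAlgebra 2), 𝔭.asIdeal.height = 1 →
          PowerSeries.C (2 : ℤ_[2]) ∉ 𝔭.asIdeal →
          lengthAt (IwasawaAlgebra 2) (IwasawaAlgebra 2 ⧸ Ideal.span {kobayashiL 1 Lplus Lminus}) 𝔭 ≤
            lengthAt (IwasawaAlgebra 2) D.X 𝔭)
    (hμ : ∀ (A : WeierstrassCurve ℚ) [A.IsElliptic] [A.IsGloballyMinimal],
      A.HasCM → A.analyticRank = 0 → GoodSS A 2 → A.frobeniusTrace 2 = 0 →
      2 ∣ A.shaOrder * A.tamagawaProduct →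
      ∀ [NeZero (A.conductorNorm ℤ)] (f : CuspForm (Gamma0 (A.conductorNorm ℤ)) 2),
      IsNewformOf A f → ∀ (Lplus Lminus : IwasawaAlgebra 2), IsPollackPair f 2 Lplus Lminus →
        ∃ n : ℕ, IsUnit (PowerSeries.coeff n (kobayashiL 1 Lplus Lminus)))
    (A : WeierstrassCurve ℚ) [A.IsElliptic] [A.IsGloballyMinimal]
    (hcm : A.HasCM) (hr : A.analyticRank = 0) (hss : GoodSS A 2) (ha : A.frobeniusTrace 2 = 0) :
    (∀ (κ : ZpExtension ℚ 2) (γ : Field.absoluteGaloisGroup ℚ), κ.IsCyclotomic → κ.IsTopGenerator γ →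
      ∀ D : SignedSelmerDualData A κ γ 1, Module.IsTorsion (IwasawaAlgebra 2) D.X ∧ D.mu = 0) ∧
    KobayashiMainConjecture A 2 1 :=
  signedMainConjectureCMTwoRankZero_body_of_pub_of_stubs hBF hmod hLrat hGZK h2 hC h412 hcork hP108 hWL
    (signedLowerDivisibilityUpToTwoPower_of_torsion_of_offTwoLower
      (signedTorsionTwoRankZero_of_pub hGZK hC h412 hcork hP108 hWL) hLD) hμ A hcm hr hss ha

end AtTwo

end SignedLowerOffTwo

end Summit.BirchSwinnertonDyer.BirchSwinnertonDyer.Theorems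

end
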